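import Summits.KontsevichZagierPeriods.KontsevichZagierPeriods.Theses.FurushoPentagon
import Literature.NumberTheory.Transcendental.MultipleZetaWeightFiveProofs

/-!
# `KernelModuloPeriodConjecture` (stmt-KontsevichZagierPeriods-15058): a refutation would prove the
# irrationality of `ζ(5)`

Cdisprove unit of the crux `KernelModuloPeriodConjecture` (route `FurushoPentagon`):
`MzvPeriodConjecture → PentagonInKZ → ReducedPeriodRing → SectorToKernel`. TRANSCENDENCE POSITIONING
of the negative side: a refutation of the crux contains a proof of its first antecedent, the period
conjecture for `MT(ℤ)` in Hoffman form (`ℚ`-linear independence of all real Hoffman multiple zeta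
values, `ζ(∅) = 1` included), and that alone settles a famous open problem:
`irrational_multipleZeta_five_of_mzvPeriodConjecture` — with the tree's weight-5 double shuffle
evaluation `5 ζ(5) = 4 ζ(3,2) + 6 ζ(2,3)` (`five_mul_multipleZeta_five`), a rational value `q` of
`ζ(5)` is the vanishing `ℚ`-combination `5q · ζ(∅) − 4 ζ(3,2) − 6 ζ(2,3) = 0` of three Hoffman values.
Hence `irrational_multipleZeta_five_of_not_kernelModuloPeriodConjecture`: NO refutation of this crux
can be filed without proving `ζ(5) ∉ ℚ` (open since Apéry 1978 settled `ζ(3)`).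

Sources: F. Brown, Ann. of Math. 175 (2012), Thm 1.1; M. Hoffman, Pacific J. Math. 152 (1992), §5;
D. Zagier, ECM 1994, §9; R. Apéry, Astérisque 61 (1979).
-/

noncomputable section

namespace Summit.KontsevichZagierPeriods.KernelModuloPeriodConjecture.Negative

open Literature.NumberTheory.Transcendental
open Summit.KontsevichZagierPeriods.KontsevichZagierPeriods.Theses.FurushoPentagon

/-- **The period conjecture for `MT(ℤ)` in Hoffman form implies `ζ(5) ∉ ℚ`.** [cite: Brown2012, Thm 1.1] -/
theorem irrational_multipleZeta_five_of_mzvPeriodConjecture (hZ : MzvPeriodConjecture) :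
    Irrational (multipleZeta [5]) := by
  rintro ⟨q, hq⟩
  classical
  have h0 : MZV.IsHoffman [] := fun _ h => by simp at h
  have h32 : MZV.IsHoffman [3, 2] := by decide
  have h23 : MZV.IsHoffman [2, 3] := by decide
  let a : {u : List ℕ // MZV.IsHoffman u} := ⟨[], h0⟩
  let b : {u : List ℕ // MZV.IsHoffman u} := ⟨[3, 2], h32⟩
  let c : {u : List ℕ // MZV.IsHoffman u} := ⟨[2, 3], h23⟩
  have hab : a ≠ b := ne_of_apply_ne Subtype.val (show ([] : List ℕ) ≠ [3, 2] by decide)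
  have hac : a ≠ c := ne_of_apply_ne Subtype.val (show ([] : List ℕ) ≠ [2, 3] by decide)
  have hbc : b ≠ c := ne_of_apply_ne Subtype.val (show ([3, 2] : List ℕ) ≠ [2, 3] by decide)
  let g : {u : List ℕ // MZV.IsHoffman u} → ℚ := fun u =>
    if u.1 = [] then 5 * q else if u.1 = [3, 2] then -4 else if u.1 = [2, 3] then -6 else 0
  have hga : g a = 5 * q := by simp [g, a]
  have hgb : g b = -4 := by simp [g, b]
  have hgc : g c = -6 := by simp [g, c]
  have h5 := five_mul_multipleZeta_five
  have hsum : ∑ u ∈ ({a, b, c} : Finset {u : List ℕ // MZV.IsHoffman u}), g u • multipleZeta u.1 = 0 := by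
    rw [Finset.sum_insert (by simp [hab, hac]), Finset.sum_insert (by simp [hbc]), Finset.sum_singleton,
      hga, hgb, hgc]
    simp only [a, b, c, Rat.smul_def, multipleZeta_nil]
    push_cast
    rw [hq]
    linarith
  have hb0 : g b = 0 := linearIndependent_iff'.mp hZ {a, b, c} g hsum b (by simp)
  rw [hgb] at hb0
  norm_num at hb0

/-- **No refutation of the crux without `ζ(5) ∉ ℚ`**: a refutation proves `MzvPeriodConjecture` (the
crux's first antecedent), hence the irrationality of `ζ(5)`. [folklore] -/
theorem irrational_multipleZeta_five_of_not_kernelModuloPeriodConjecture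
    (h : ¬ KernelModuloPeriodConjecture) : Irrational (multipleZeta [5]) := by
  refine irrational_multipleZeta_five_of_mzvPeriodConjecture ?_
  by_contra hZ
  exact h fun z => absurd z hZ

end Summit.KontsevichZagierPeriods.KernelModuloPeriodConjecture.Negative

end
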